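import Literature.Analysis.FluidPDE.GKPCriticalElementsProofs
import Literature.Analysis.FluidPDE.GKPRegularityPersistence
import HarnessLib

/-!
# GKP Proposition 2.1 over Gallagher–Koch–Planchon's own solution class

Sibling file of `Literature/Analysis/FluidPDE/GKPCriticalElements.lean` (named fact
`Literature.Analysis.FluidPDE.gkp_exists_criticalElement` = Gallagher–Koch–Planchon 2016, Prop. 2.1:
"if `A_c < ∞`, then the set `𝒟_c` is non empty") and of `GKPRegularityPersistence.lean` (GKP's
path-space class `MemGKPPathSpace` = `𝓛^{1:∞}_{p,q}[T' < T]` and the audit of the standing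
identification of `CriticalRegularity.lean`). It is the outcome of the attempt to *discharge*
Prop. 2.1: it records, inside the tree, what separates the vendored statement from the printed one,
writes down the statement transported to GKP's own class, and proves the bookkeeping implication
between the two. Theorems only: no definition, no named fact, nothing in the sibling files changes.

## What is printed (arXiv:1407.4156, pp. 4, 6, 8)

`A_c` and `𝒟_c` (§2.1, p. 6) are defined through `NS(u₀)`, "the unique strong Navier–Stokes
solution" of the Duhamel equation (1.2) in the path space `X_T = 𝓛^{1:∞}_{p,q}(T)` (p. 4: existence,
and the uniqueness statement "`u₁, u₂` satisfy (1.2) in `𝓛^{1:∞}_{p,q}(T)` ⟹ `u₁ = u₂`"), and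
through its maximal time `T*(u₀) = T*_{𝓛^{1:∞}_{p,q}(T)}(u₀)` ((1.3)):
`A_c = sup {A | sup_{[0,T*(u₀))} ‖NS(u₀)‖ ≤ A ⟹ T*(u₀) = ∞}`, equal when finite to
`inf {sup_{[0,T*(u₀))} ‖NS(u₀)‖ | T*(u₀) < ∞}`, and
`𝒟_c = {u₀ | T*(u₀) < ∞, sup_{[0,T*(u₀))} ‖NS(u₀)‖ = A_c}`. The proof of Prop. 2.1 (§2.3, p. 8)
takes a minimizing sequence of data `u_{0,n}` and applies Thm. 3 (NS evolution of the profile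
decomposition of the data) to **`u_n := NS(u_{0,n})`**: the lifespans `T*(u_{0,n})` and the bounds
`A_n` entering the argument are those of the canonical solutions, the profiles evolve by `NS(·)`,
and the critical element is `NS(φ₁)` with `T*₁ = T*(φ₁)`.

## What the vendored statement says instead

`gkp_exists_criticalElement` quantifies, on both sides, over the tree's class: `A_c` is
`criticalBesovThreshold ν p`, an infimum over **all** `IsMaximalBesovMildSolution` solutions
(duality-form mild identity from `t = 0`, Kato's class `K_∞`, `C([0,T); Ḃ^{s_p}_{p,p})` through the
distributions of the slices, no extension *in that class*), and a critical element is such a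
solution realising the infimum (`IsCriticalElement`). The two statements agree under the standing
identification of `CriticalRegularity.lean` — every member of the tree's class from the datum `u₀`
*is* `NS(u₀)` on its interval — i.e. under the hypothesis that the tree's class lies in GKP's path
space (`hId` below, the same hypothesis as in `gkp_regularity_persistence_of_pathSpace`). That
identification is not a published result (audit in `GKPRegularityPersistence.lean`: continuity in
the critical Besov space alone is not a uniqueness class, Fujii 2026, Thm. 1.2 (N2); and no printed
uniqueness theorem covers Kato's `K_∞` without an `L²`-in-time integrability at `t = 0`, Miura 2005,
Thm. 2.3). For a member `(u, U)` of the tree's class which is not `NS(u 0)`, nothing in §2.3 relates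
its lifespan or its bound `sup ‖U t‖` to the profiles of its datum, so the printed proof does not
reach the vendored statement; and since the two thresholds are infima over a priori different
classes, neither implication between "Prop. 2.1 for the tree's class" and "Prop. 2.1 as printed" is
available without `hId`. (Whether the tree's class is in fact a uniqueness class is, as far as the
sources go, open; nothing here asserts that the vendored statement is false.)

## The statement over GKP's class (hypothesis `hP`; for a later `definition` proposal, D-0026)

With "GKP solution on `[0, T)`" :=
`IsBesovMildSolutionOn (-1+3/p) p p T ν u U ∧ MemGKPPathSpace p p T U` (the restriction of `NS(u 0)`
to `[0, T)`, `T ≤ T*`: in `𝓛^{1:∞}` the Duhamel term converges absolutely and such solutions are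
unique, (1.7) of the arXiv version) and "`T = T*`" := no GKP solution on a longer interval extends
`(u, U)`, Prop. 2.1 reads, in the `inf` form of `A_c` printed in §2.1: *if some GKP solution has
finite maximal time `T₀` and `sup_{[0,T₀)} ‖U₀ t‖ < ∞` (i.e. `A_c < ∞`), then there is a GKP
solution with finite maximal time `T` whose `sup_{[0,T)} ‖U t‖` is `≤` that of every GKP solution
with finite maximal time (i.e. `𝒟_c ≠ ∅`)*. This is hypothesis `hP` of
`gkp_exists_criticalElement_of_pathSpace`, verbatim; data are function-valued as everywhere in this
file family (GKP §2.4: time translates of critical elements are critical elements, and they are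
smooth by (1.6)), and the viscosity is general. It is not vendored as a named fact here (this file
adds no debt); its proof is GKP §2.3 and rests on Koch's profile decomposition (Thm. 2), its
Navier–Stokes evolution (Thm. 3, with App. A) and the orthogonality Prop. 2.6 — a theory absent from
Mathlib and from this tree (see `GKPCriticalElementsProofs.lean`).

## What this file proves

* `IsMaximalBesovMildSolution.not_exists_extension_pathSpace` — a maximal solution of the tree has,
  in particular, no extension in GKP's class;
* `isMaximalBesovMildSolution_of_not_exists_extension_pathSpace`,
  `isMaximalBesovMildSolution_iff_pathSpace` — under `hId` the two maximality notions coincide;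
* `gkp_exists_criticalElement_of_pathSpace : hP → hId → gkp_exists_criticalElement` — the vendored
  Prop. 2.1 is the printed one **plus** the identification: from `A_c < ∞` pick a blowing-up maximal
  solution with bounded norm (`exists_isMaximal_biSup_lt`), read it in GKP's class by `hId`, let
  `hP` produce a minimiser, read it back as a maximal solution of the tree, and compare its `sup`
  with `A_c = inf` (`criticalBesovThreshold_eq_iInf`, `IsCriticalElement.of_biSup_le`).

## References

* I. Gallagher, G. S. Koch, F. Planchon, *Blow-up of critical Besov norms at a potential
  Navier–Stokes singularity*, Comm. Math. Phys. 343 (2016) 39–82 = arXiv:1407.4156: p. 4 ((1.2),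
  (1.3), existence and uniqueness of `NS(u₀)` in `𝓛^{1:∞}_{p,q}(T)`), §2.1 p. 6 (`A_c`, `𝒟_c`,
  Prop. 2.1), §2.3 p. 8 (proof of Prop. 2.1), §2.4 (time translates). [cite: GKP2016, Prop. 2.1]
* M. Fujii, *Sharp non-uniqueness for the Navier–Stokes equations in scaling critical spaces*,
  arXiv:2602.19846 (2026), Thm. 1.2, Rem. 1.3. [cite: Fujii2026, Thm. 1.2]
* H. Miura, *Remark on uniqueness of mild solutions to the Navier–Stokes equations*, J. Funct.
  Anal. 218 (2005) 110–129, Thm. 2.3. [cite: Miura2005, Thm. 2.3]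
-/

noncomputable section

open MeasureTheory TemperedDistribution Set Function Filter Topology
open scoped SchwartzMap ENNReal NNReal

namespace Literature.Analysis.FluidPDE

/-! ## Maximality in the tree's class versus maximality in GKP's path-space class -/

section PathSpaceMaximal

variable {s : ℝ} {p q : ℝ≥0∞} [Fact (1 ≤ p)] {T ν : ℝ}
  {u : ℝ → EuclideanSpace ℝ (Fin 3) → EuclideanSpace ℝ (Fin 3)}
  {U : ℝ → 𝓢'(EuclideanSpace ℝ (Fin 3), EuclideanSpace ℂ (Fin 3))}

/-- A maximal Besov mild solution (no extension in the tree's class `IsBesovMildSolutionOn`) has in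
particular no extension in GKP's class "Besov mild solution lying in `𝓛^{1:∞}_{p,q}[T' < T]`"
(`MemGKPPathSpace`; GKP 2016, p. 4: `T*` is the maximal time of `NS(u₀)` in `𝓛^{1:∞}_{p,q}`).
[cite: GKP2016, (1.3)] -/
theorem IsMaximalBesovMildSolution.not_exists_extension_pathSpace
    (hmax : IsMaximalBesovMildSolution s p q T ν u U) :
    ¬ ∃ T' > T, ∃ (v : ℝ → EuclideanSpace ℝ (Fin 3) → EuclideanSpace ℝ (Fin 3))
        (V : ℝ → 𝓢'(EuclideanSpace ℝ (Fin 3), EuclideanSpace ℂ (Fin 3))),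
      (IsBesovMildSolutionOn s p q T' ν v V ∧ MemGKPPathSpace p q T' V) ∧
        ∀ t ∈ Ico 0 T, v t =ᵐ[volume] u t := by
  rintro ⟨T', hT', v, V, ⟨hv, -⟩, hvu⟩
  exact hmax.not_extendable ⟨T', hT', v, V, hv, hvu⟩

/-- Under the identification `hId` of the tree's class with GKP's (every Besov mild solution on
`[0, T')` lies in `𝓛^{1:∞}_{p,q}[T'' < T']`, the hypothesis audited in
`GKPRegularityPersistence.lean`), a Besov mild solution on `[0, T)`, `0 < T`, with no extension in
GKP's class is maximal in the tree's sense: an extension in the tree's class would lie in the path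
space by `hId`. [cite: GKP2016, (1.3)] -/
theorem isMaximalBesovMildSolution_of_not_exists_extension_pathSpace
    (hId : ∀ ⦃T' : ℝ⦄, 0 < T' →
      ∀ ⦃v : ℝ → EuclideanSpace ℝ (Fin 3) → EuclideanSpace ℝ (Fin 3)⦄
        ⦃V : ℝ → 𝓢'(EuclideanSpace ℝ (Fin 3), EuclideanSpace ℂ (Fin 3))⦄,
        IsBesovMildSolutionOn s p q T' ν v V → MemGKPPathSpace p q T' V)
    (hT : 0 < T) (hu : IsBesovMildSolutionOn s p q T ν u U)
    (h : ¬ ∃ T' > T, ∃ (v : ℝ → EuclideanSpace ℝ (Fin 3) → EuclideanSpace ℝ (Fin 3))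
        (V : ℝ → 𝓢'(EuclideanSpace ℝ (Fin 3), EuclideanSpace ℂ (Fin 3))),
      (IsBesovMildSolutionOn s p q T' ν v V ∧ MemGKPPathSpace p q T' V) ∧
        ∀ t ∈ Ico 0 T, v t =ᵐ[volume] u t) :
    IsMaximalBesovMildSolution s p q T ν u U where
  isBesovMildSolutionOn := hu
  not_extendable := by
    rintro ⟨T', hT', v, V, hv, hvu⟩
    exact h ⟨T', hT', v, V, ⟨hv, hId (hT.trans hT') hv⟩, hvu⟩

/-- **Under the identification, the two maximality notions coincide**: granted `hId` (every Besov
mild solution on `[0, T')` lies in GKP's path space `𝓛^{1:∞}_{p,q}[T'' < T']`), a pair `(u, U)` on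
`[0, T)`, `0 < T`, is a maximal Besov mild solution of the tree iff it is a Besov mild solution in
GKP's class with no extension in GKP's class — the tree's rendering of "`T = T*(u₀)`"
(GKP 2016, (1.3)). [cite: GKP2016, (1.3)] -/
theorem isMaximalBesovMildSolution_iff_pathSpace
    (hId : ∀ ⦃T' : ℝ⦄, 0 < T' →
      ∀ ⦃v : ℝ → EuclideanSpace ℝ (Fin 3) → EuclideanSpace ℝ (Fin 3)⦄
        ⦃V : ℝ → 𝓢'(EuclideanSpace ℝ (Fin 3), EuclideanSpace ℂ (Fin 3))⦄,
        IsBesovMildSolutionOn s p q T' ν v V → MemGKPPathSpace p q T' V)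
    (hT : 0 < T) :
    IsMaximalBesovMildSolution s p q T ν u U ↔
      IsBesovMildSolutionOn s p q T ν u U ∧ MemGKPPathSpace p q T U ∧
        ¬ ∃ T' > T, ∃ (v : ℝ → EuclideanSpace ℝ (Fin 3) → EuclideanSpace ℝ (Fin 3))
            (V : ℝ → 𝓢'(EuclideanSpace ℝ (Fin 3), EuclideanSpace ℂ (Fin 3))),
          (IsBesovMildSolutionOn s p q T' ν v V ∧ MemGKPPathSpace p q T' V) ∧
            ∀ t ∈ Ico 0 T, v t =ᵐ[volume] u t :=
  ⟨fun h => ⟨h.isBesovMildSolutionOn, hId hT h.isBesovMildSolutionOn,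
      h.not_exists_extension_pathSpace⟩,
    fun h => isMaximalBesovMildSolution_of_not_exists_extension_pathSpace hId hT h.1 h.2.2⟩

end PathSpaceMaximal

/-! ## The vendored Proposition 2.1 = the printed one over GKP's class + the identification -/

section Prop21

/-- **`gkp_exists_criticalElement` = Prop. 2.1 over GKP's class `𝓛^{1:∞}_p[T' < T]` + the
identification of the tree's class with `NS(u₀)`.** Hypothesis `hP` is GKP 2016, Prop. 2.1
transported to Gallagher–Koch–Planchon's own solution class (module docstring, §"The statement over
GKP's class"): with "GKP solution on `[0, T)`" = Besov mild solution of the class `(s_p, p, p)`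
lying in `𝓛^{1:∞}_p[T' < T]` (`MemGKPPathSpace p p T U`) and "`T = T*`" = no GKP solution on a
longer interval extends it, *if some GKP solution has finite maximal time and bounded critical norm
(`A_c < ∞`, second formula of §2.1), then some GKP solution with finite maximal time has the least
`sup_{[0,T)} ‖U t‖_{Ḃ^{s_p}_{p,p}}` among all GKP solutions with finite maximal time (`𝒟_c ≠ ∅`)*,
for GKP exponents `p = 3·2^k - 2` and any viscosity `ν > 0`. Hypothesis `hId` is the standing
identification of `CriticalRegularity.lean` in the form used by
`gkp_regularity_persistence_of_pathSpace` — every `IsBesovMildSolutionOn` solution lies in GKP's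
path space — which is **not** a published result and is not asserted here. Together they give the
vendored `gkp_exists_criticalElement`: from `A_c < ∞` there is a blowing-up maximal solution with
bounded norm (`exists_isMaximal_biSup_lt`); by `hId` it is a GKP solution with `T = T*`
(`IsMaximalBesovMildSolution.not_exists_extension_pathSpace`); `hP` yields a minimiser, which is
maximal in the tree's sense (`isMaximalBesovMildSolution_of_not_exists_extension_pathSpace`) and
whose `sup` is `≤ A_c = inf` over the tree's blowing-up maximal solutions
(`criticalBesovThreshold_eq_iInf`, each of them being a GKP solution with `T = T*` by `hId` again),
hence a critical element (`IsCriticalElement.of_biSup_le`). [cite: GKP2016, Prop. 2.1] -/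
theorem gkp_exists_criticalElement_of_pathSpace
    (hP : ∀ ⦃ν : ℝ⦄, 0 < ν → ∀ ⦃p : ℝ≥0∞⦄ [Fact (1 ≤ p)], IsGKPExponent p →
      ∀ ⦃T₀ : ℝ⦄ ⦃u₀ : ℝ → EuclideanSpace ℝ (Fin 3) → EuclideanSpace ℝ (Fin 3)⦄
        ⦃U₀ : ℝ → 𝓢'(EuclideanSpace ℝ (Fin 3), EuclideanSpace ℂ (Fin 3))⦄, 0 < T₀ →
        IsBesovMildSolutionOn (-1 + 3 / p.toReal) p p T₀ ν u₀ U₀ → MemGKPPathSpace p p T₀ U₀ →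
        (¬ ∃ T' > T₀, ∃ (v : ℝ → EuclideanSpace ℝ (Fin 3) → EuclideanSpace ℝ (Fin 3))
            (V : ℝ → 𝓢'(EuclideanSpace ℝ (Fin 3), EuclideanSpace ℂ (Fin 3))),
            (IsBesovMildSolutionOn (-1 + 3 / p.toReal) p p T' ν v V ∧ MemGKPPathSpace p p T' V) ∧
              ∀ t ∈ Ico 0 T₀, v t =ᵐ[volume] u₀ t) →
        ⨆ t ∈ Ico 0 T₀, FunctionSpaces.eHomBesovNorm (-1 + 3 / p.toReal) p p (U₀ t) < ∞ →
        ∃ (T : ℝ) (u : ℝ → EuclideanSpace ℝ (Fin 3) → EuclideanSpace ℝ (Fin 3))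
          (U : ℝ → 𝓢'(EuclideanSpace ℝ (Fin 3), EuclideanSpace ℂ (Fin 3))), 0 < T ∧
          IsBesovMildSolutionOn (-1 + 3 / p.toReal) p p T ν u U ∧ MemGKPPathSpace p p T U ∧
          (¬ ∃ T' > T, ∃ (v : ℝ → EuclideanSpace ℝ (Fin 3) → EuclideanSpace ℝ (Fin 3))
              (V : ℝ → 𝓢'(EuclideanSpace ℝ (Fin 3), EuclideanSpace ℂ (Fin 3))),
              (IsBesovMildSolutionOn (-1 + 3 / p.toReal) p p T' ν v V ∧ MemGKPPathSpace p p T' V) ∧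
                ∀ t ∈ Ico 0 T, v t =ᵐ[volume] u t) ∧
          ∀ ⦃T₁ : ℝ⦄ ⦃u₁ : ℝ → EuclideanSpace ℝ (Fin 3) → EuclideanSpace ℝ (Fin 3)⦄
            ⦃U₁ : ℝ → 𝓢'(EuclideanSpace ℝ (Fin 3), EuclideanSpace ℂ (Fin 3))⦄, 0 < T₁ →
            IsBesovMildSolutionOn (-1 + 3 / p.toReal) p p T₁ ν u₁ U₁ → MemGKPPathSpace p p T₁ U₁ →
            (¬ ∃ T' > T₁, ∃ (v : ℝ → EuclideanSpace ℝ (Fin 3) → EuclideanSpace ℝ (Fin 3))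
                (V : ℝ → 𝓢'(EuclideanSpace ℝ (Fin 3), EuclideanSpace ℂ (Fin 3))),
                (IsBesovMildSolutionOn (-1 + 3 / p.toReal) p p T' ν v V ∧
                    MemGKPPathSpace p p T' V) ∧
                  ∀ t ∈ Ico 0 T₁, v t =ᵐ[volume] u₁ t) →
            ⨆ t ∈ Ico 0 T, FunctionSpaces.eHomBesovNorm (-1 + 3 / p.toReal) p p (U t) ≤
              ⨆ t ∈ Ico 0 T₁, FunctionSpaces.eHomBesovNorm (-1 + 3 / p.toReal) p p (U₁ t))
    (hId : ∀ ⦃ν : ℝ⦄, 0 < ν → ∀ ⦃p q : ℝ≥0∞⦄ [Fact (1 ≤ p)], 3 < p → p < ∞ → 3 < q → q < ∞ →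
      ∀ ⦃T : ℝ⦄, 0 < T → ∀ ⦃u : ℝ → EuclideanSpace ℝ (Fin 3) → EuclideanSpace ℝ (Fin 3)⦄
        ⦃U : ℝ → 𝓢'(EuclideanSpace ℝ (Fin 3), EuclideanSpace ℂ (Fin 3))⦄,
        IsBesovMildSolutionOn (-1 + 3 / p.toReal) p q T ν u U → MemGKPPathSpace p q T U) :
    gkp_exists_criticalElement := by
  intro ν hν p _ hp hA
  -- the identification, specialised to the diagonal class `(s_p, p, p)` at this `(ν, p)`
  have hId' : ∀ ⦃T' : ℝ⦄, 0 < T' →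
      ∀ ⦃v : ℝ → EuclideanSpace ℝ (Fin 3) → EuclideanSpace ℝ (Fin 3)⦄
        ⦃V : ℝ → 𝓢'(EuclideanSpace ℝ (Fin 3), EuclideanSpace ℂ (Fin 3))⦄,
        IsBesovMildSolutionOn (-1 + 3 / p.toReal) p p T' ν v V → MemGKPPathSpace p p T' V :=
    fun T' hT' v V hv => hId hν hp.three_lt hp.lt_top hp.three_lt hp.lt_top hT' hv
  -- `A_c < ∞`: some maximal solution of the tree blows up with bounded critical norm
  obtain ⟨T₀, u₀, U₀, hT₀, hmax₀, -, hlt₀⟩ := exists_isMaximal_biSup_lt hA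
  -- read it in GKP's class and let Prop. 2.1 (over GKP's class) produce a minimiser
  obtain ⟨T, u, U, hT, hu, -, hnoext, hmin⟩ := hP hν hp hT₀ hmax₀.isBesovMildSolutionOn
    (hId' hT₀ hmax₀.isBesovMildSolutionOn) hmax₀.not_exists_extension_pathSpace hlt₀
  -- the minimiser is maximal in the tree's sense …
  have hmax : IsMaximalBesovMildSolution (-1 + 3 / p.toReal) p p T ν u U :=
    isMaximalBesovMildSolution_of_not_exists_extension_pathSpace hId' hT hu hnoext
  -- … and its `sup` is `≤ A_c = inf` over the tree's blowing-up maximal solutions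
  refine ⟨T, u, U, IsCriticalElement.of_biSup_le hT hmax ?_ hA⟩
  rw [criticalBesovThreshold_eq_iInf]
  exact le_iInf fun T₁ => le_iInf fun u₁ => le_iInf fun U₁ => le_iInf fun hT₁ =>
    le_iInf fun hmax₁ => hmin hT₁ hmax₁.isBesovMildSolutionOn
      (hId' hT₁ hmax₁.isBesovMildSolutionOn) hmax₁.not_exists_extension_pathSpace

end Prop21

end Literature.Analysis.FluidPDE
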